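import Summits.QuantumFields.BalabanUV.T4Continuum.Support.MinimalActionRate
import Mathlib.Analysis.Normed.Ring.Units
import HarnessLib

/-!
# T⁴ programme, node NE3 (η-rate of the minimisers) — THE ACTION SANDWICH, supplier A-H1-cpt, part 1:
# COMPACTNESS OF THE SMALL-FIELD CLASS AND CONTINUITY OF THE `k`-FOLD AVERAGE (43) ON IT

NE3 formalisation swarm `b2b-balaban-t4-ne3-formalise-*` of the cell `pub-balaban`, unit `b2b-balaban-t4-ne3-formalise-leaf-05`
(gen 2), supplier node «A-H1-cpt» under leaf A-H1 of the owner's skeleton `t4/b2b-balaban-t4-ne3-p1/SKELETON-NE3-P1.md`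
v1.2 §3 (journal `HOME/CLAIMS.log` INTENT line of 2026-08-20T07:43Z).  Leaf A-H1 of route (A) is the EXISTENCE of a
minimiser of every run (`SandwichData.exists_minimiser`, `MinimalActionRate`); the skeleton's census N-ne3p1-46 (n3)
recorded «existence by compactness would replace (H1) only modulo NON-EMPTINESS of the finer admissible sets, itself
Thm-1-type — not pursued».  Since the re-cut v1.1/v1.2 non-emptiness IS the kinematic refinement (H2) (`SmoothRefine` ⇐
`ApproxRefine` + the owner's chain-end correction), so compactness now removes A-H1 from the B11-Thm-1-TYPE leaves.  This
part supplies the topology; part 2 (`MinimalActionExistence`) the extreme-value argument and the induction on the level.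

CONTENT (all [folklore]; generic lattice-gauge kinematics, manuscript-free):
§1 continuity, in the product topology of `Site d → Fin d → M_N(ℂ)ˣ` (Mathlib's `Units` topology on `M_N(ℂ)ˣ`), of the
   parallel transports (9) along a fixed word, of the loop variables of (42), of the Wilson weight and of
   `MinimalActionLevels.levelAction`;
§2 `isCompact_isUnitaryCfg` (Tychonoff over ALL bonds of `ℤ^d` × compactness of `U(N)`, tree
   `Matrix.unitaryGroup.instCompactSpace`), closedness of `IsPeriodicCfg` and `SmallField`, hence **`isCompact_sfClass`**;
§3 `continuousOn_rescale_bavg`: the one-step average (42) read on the next lattice is continuous on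
   `{U | IsUnitaryCfg U ∧ SmallField U a}`, `512(d+1)(d+4)L²a ≤ 1` — every loop variable lies within `1/4` of `1`
   (`MinimalActionLevels.norm_Wcx_sub_one_le_quarter`), where the series (21) is analytic (`MatrixLog.analyticAt_mlog`);
§4 `avgIter_unitary_smallField(_two)`: B7 Prop. 1 iterated SCALE BY SCALE (`avgRadius_scale_step`: the second-order loss at
   scale `L^{−m}` is `≤ 4C₀ε²4^{−m}`, a convergent geometric series) — every intermediate average of a configuration with
   `SmallField U (ε/(L^k)²)` is `U(N)`-valued with `SmallField · (2ε)`, UNIFORMLY in `k`, once `16·C₀·ε ≤ 3` and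
   `1024(d+1)(d+4)L²ε ≤ 1` (`C₀ = B7Prop2Explicit.C0 d = 226·(8(d+1)(d+4))²`; this is the regime `α₀ ≤ c₂` of B7 Prop. 2
   (52)–(54), cf. the tree's `B7Prop2Explicit.prop2_unitaryUnits` in the `pdev`/`<` vocabulary);
§5 **`continuousOn_avgIter`**: the `j`-fold average (43), `j ≤ k`, is continuous on the small-field class of level `k`.

HONEST FRAMING.  Finite-T⁴ bookkeeping about Bałaban's block averages (rung (B)+1 of the cell's ladder: the finite-torus
continuum limit of gauge-invariant observables — NOT infinite volume, NO mass gap, NOT the Clay problem, NOT summit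
progress).  NE3 is NOT proved here or anywhere; no conditional of the cell (`BetaPertH`, (B), G-an2-4) occurs; nothing
printed is a hypothesis (B7 Prop. 1 enters as the tree's kernel theorem `prop1_explicit` via `smallField_rescale_bavg`).
Imports BY NAME: `sfClass`, `SmallField`, `IsUnitaryCfg`, `IsPeriodicCfg`, `avgIter`, `bavg`, `rescale`, `Wcx`, `Xavg`,
`levelAction`, `avgRadius`; nothing restated; no `def`, no `sorry`.  Context: T. Bałaban, Commun. Math. Phys. **98** (1985)
17–51 [Balaban1985Averaging] (42)–(43) pp. 23–24, Prop. 1–2 p. 26; **102** (1985) 277–309 [Balaban1985Variational] (5)–(8)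
p. 278.  PLACEMENT: `Summits/QuantumFields/BalabanUV/` (human rule 2026-08-19).  Record: `t4/formal/NE3/LEAVES.md`.
HONEST DEPENDENCY: continuum YM on T⁴ ⇐ BetaPertH ∧ nine spine estimates (0/9 proved); BetaPertH ⇐ (D1) ∧ (D4) ∧ CAP+tail;
G-an2-4 gates asym, D1 and NE2/3/4.
-/

set_option autoImplicit false

open scoped BigOperators Matrix Matrix.Norms.L2Operator Topology
open NormedSpace Finset

namespace Summit.QuantumFields.BalabanUV.T4Continuum.MinimalActionCompact

open Literature.MathematicalPhysics.QuantumFieldTheory.Balaban1983to89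
open B7Prop1Explicit B7Prop2Explicit MatrixLog UnitaryModel
open T4AveragingDeficitWall hiding Site Plane Plaq Bond
open T4AveragingDeficitWallBoundary (IsPeriodicCfg)
open MinimalActionLevels MinimalActionSandwich MinimalActionRate

noncomputable section

variable {d : ℕ} {n : Type*} [Fintype n] [DecidableEq n]

/-! ## §1 Continuity of the lattice words (9) and of the Wilson weight in the product topology -/

/-- Evaluation of a configuration at a bond is continuous (product topology). [folklore] -/
theorem continuous_eval (x : Site d) (κ : Fin d) :
    Continuous fun U : Site d → Fin d → (Matrix n n ℂ)ˣ => U x κ :=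
  (continuous_apply κ).comp (continuous_apply x)

/-- The bond variable traversed by a letter depends continuously on the configuration. [folklore] -/
theorem continuous_stepHol (x : Site d) (l : Letter d) :
    Continuous fun U : Site d → Fin d → (Matrix n n ℂ)ˣ => stepHol U x l := by
  obtain ⟨μ, b⟩ := l
  cases b
  · simp only [stepHol]
    exact (continuous_eval _ μ).inv
  · simp only [stepHol]
    exact continuous_eval x μ

/-- **Parallel transport (9) along a fixed word is continuous in the configuration.** [folklore] -/
theorem continuous_hol (x : Site d) (w : List (Letter d)) :
    Continuous fun U : Site d → Fin d → (Matrix n n ℂ)ˣ => hol U x w := by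
  induction w generalizing x with
  | nil => simpa only [hol_nil] using continuous_const
  | cons l w ih =>
      simp only [hol_cons]
      exact (continuous_stepHol x l).mul (ih (x + l.vec))

/-- The matrix value of the transport is continuous. [folklore] -/
theorem continuous_val_hol (x : Site d) (w : List (Letter d)) :
    Continuous fun U : Site d → Fin d → (Matrix n n ℂ)ˣ => ((hol U x w : (Matrix n n ℂ)ˣ) : Matrix n n ℂ) :=
  Units.continuous_val.comp (continuous_hol x w)

/-- The loop variable `V(Γ_{c,x})V(c)⁻¹` of (42) is continuous in the configuration. [folklore] -/
theorem continuous_Wcx (L : ℕ) (q : Site d) (κ : Fin d) (r : Site d) :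
    Continuous fun U : Site d → Fin d → (Matrix n n ℂ)ˣ => Wcx L U q κ r := by
  unfold Wcx
  exact (continuous_hol q _).mul (continuous_hol q _).inv

/-- The Wilson weight `1 − Re tr U(∂p)` of a fixed plaquette is continuous in the configuration. [folklore] -/
theorem continuous_wt_fhol (p : T4AveragingDeficitWall.Plaq d) :
    Continuous fun U : Site d → Fin d → (Matrix n n ℂ)ˣ => wt (fhol U p) := by
  unfold wt fhol
  exact continuous_const.sub (continuous_nReTr.comp (continuous_val_hol _ _))

/-- **The level-`k` Wilson action is continuous in the configuration** (a finite sum of Wilson weights).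
[folklore] -/
theorem continuous_levelAction (L N k : ℕ) :
    Continuous fun U : Site d → Fin d → (Matrix n n ℂ)ˣ => levelAction d L N k U := by
  unfold levelAction fineAction
  exact continuous_const.mul (continuous_finsetSum _ fun p _ => continuous_wt_fhol p)

/-! ## §2 Compactness of the unitary configurations; closedness of periodicity and of the small-field class -/

/-- The unitary units `{u ∈ M_N(ℂ)ˣ : u ∈ U(N)}` form a compact subset of the units (the range of the continuous
map `u ↦ (u, u⋆)` on the compact group `U(N)`, tree `Matrix.unitaryGroup.instCompactSpace`). [folklore] -/
theorem isCompact_unitaryUnits :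
    IsCompact {u : (Matrix n n ℂ)ˣ | (u : Matrix n n ℂ) ∈ unitary (Matrix n n ℂ)} := by
  have hφ : Continuous (Unitary.toUnits : unitary (Matrix n n ℂ) → (Matrix n n ℂ)ˣ) := by
    refine Units.continuous_iff.mpr ⟨continuous_subtype_val, ?_⟩
    exact continuous_subtype_val.comp continuous_star
  have hset : Set.range (Unitary.toUnits : unitary (Matrix n n ℂ) → (Matrix n n ℂ)ˣ)
      = {u : (Matrix n n ℂ)ˣ | (u : Matrix n n ℂ) ∈ unitary (Matrix n n ℂ)} := by
    ext u
    constructor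
    · rintro ⟨x, rfl⟩
      exact x.2
    · intro hu
      exact ⟨⟨(u : Matrix n n ℂ), hu⟩, Units.ext rfl⟩
  rw [← hset]
  exact isCompact_range hφ

/-- **The `U(N)`-valued configurations on all of `ℤ^d` form a COMPACT set** (Tychonoff). [folklore] -/
theorem isCompact_isUnitaryCfg :
    IsCompact {U : Site d → Fin d → (Matrix n n ℂ)ˣ | IsUnitaryCfg U} := by
  have h : {U : Site d → Fin d → (Matrix n n ℂ)ˣ | IsUnitaryCfg U}
      = {U | ∀ x, U x ∈ {g : Fin d → (Matrix n n ℂ)ˣ | ∀ κ, g κ ∈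
          {u : (Matrix n n ℂ)ˣ | (u : Matrix n n ℂ) ∈ unitary (Matrix n n ℂ)}}} := by
    ext U
    simp only [Set.mem_setOf_eq, IsUnitaryCfg, mem_unitaryUnits]
  rw [h]
  exact isCompact_pi_infinite fun _ => isCompact_pi_infinite fun _ => isCompact_unitaryUnits

/-- Periodicity is a closed condition. [folklore] -/
theorem isClosed_isPeriodicCfg (P : ℤ) :
    IsClosed {U : Site d → Fin d → (Matrix n n ℂ)ˣ | IsPeriodicCfg U P} := by
  simp only [IsPeriodicCfg, Set.setOf_forall]
  exact isClosed_iInter fun x => isClosed_iInter fun κ => isClosed_iInter fun μ =>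
    isClosed_eq (continuous_eval _ μ) (continuous_eval x μ)

/-- The small-field class (44) of radius `a` is closed. [folklore] -/
theorem isClosed_smallField (a : ℝ) :
    IsClosed {U : Site d → Fin d → (Matrix n n ℂ)ˣ | SmallField U a} := by
  simp only [SmallField, Set.setOf_forall]
  exact isClosed_iInter fun x => isClosed_iInter fun κ => isClosed_iInter fun κ' => isClosed_iInter fun _ =>
    isClosed_le ((continuous_val_hol x (plaqWord κ κ')).sub continuous_const).norm continuous_const

/-- **THE SMALL-FIELD CLASS `sfClass d L N ε k` IS COMPACT.** [folklore] -/
theorem isCompact_sfClass (L N : ℕ) (ε : ℝ) (k : ℕ) : IsCompact (sfClass (n := n) d L N ε k) := by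
  have h : sfClass d L N ε k = {U : Site d → Fin d → (Matrix n n ℂ)ˣ | IsUnitaryCfg U}
      ∩ ({U | IsPeriodicCfg U ((N * L ^ k : ℕ) : ℤ)} ∩ {U | SmallField U (ε / ((L : ℝ) ^ k) ^ 2)}) := by
    ext U; simp only [sfClass, Set.mem_setOf_eq, Set.mem_inter_iff]
  rw [h]
  exact isCompact_isUnitaryCfg.inter_right ((isClosed_isPeriodicCfg _).inter (isClosed_smallField _))

/-! ## §3 Continuity of the one-step average (42) on the small-field class -/

/-- On the small-field class with `512(d+1)(d+4)L²a ≤ 1` the exponent `X_c` of (42) is continuous: every loop variable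
lies within `1/4` of `1` (`norm_Wcx_sub_one_le_quarter`), inside the ball where the series (21) is analytic
(`MatrixLog.analyticAt_mlog`). [folklore] -/
theorem continuousOn_Xavg [Nonempty n] (L : ℕ) (hL : 1 ≤ L) {a : ℝ} (ha : 0 ≤ a)
    (hsmall : 512 * (d + 1) * (d + 4) * (L : ℝ) ^ 2 * a ≤ 1) (q : Site d) (κ : Fin d) :
    ContinuousOn (fun U : Site d → Fin d → (Matrix n n ℂ)ˣ => Xavg L U q κ)
      {U | IsUnitaryCfg U ∧ SmallField U a} := by
  unfold Xavg
  refine continuousOn_finsetSum _ fun r _ => ?_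
  refine ContinuousOn.const_smul (fun U hU => ?_) _
  have hW : ‖((Wcx L U q κ (boxVec L r) : (Matrix n n ℂ)ˣ) : Matrix n n ℂ) - 1‖ < 1 :=
    (norm_Wcx_sub_one_le_quarter L hL hU.1 ha hsmall hU.2 q κ r).trans_lt (by norm_num)
  have hf : ContinuousWithinAt
      (fun U : Site d → Fin d → (Matrix n n ℂ)ˣ => ((Wcx L U q κ (boxVec L r) : (Matrix n n ℂ)ˣ) : Matrix n n ℂ))
      {U | IsUnitaryCfg U ∧ SmallField U a} U :=
    (Units.continuous_val.comp (continuous_Wcx L q κ (boxVec L r))).continuousWithinAt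
  exact ContinuousAt.comp_continuousWithinAt (g := mlog)
    (f := fun U : Site d → Fin d → (Matrix n n ℂ)ˣ =>
      ((Wcx L U q κ (boxVec L r) : (Matrix n n ℂ)ˣ) : Matrix n n ℂ))
    (analyticAt_mlog hW).continuousAt hf

/-- **The one-step average (42), read on the next lattice, is continuous on the small-field class.** [folklore] -/
theorem continuousOn_rescale_bavg [Nonempty n] (L : ℕ) (hL : 1 ≤ L) {a : ℝ} (ha : 0 ≤ a)
    (hsmall : 512 * (d + 1) * (d + 4) * (L : ℝ) ^ 2 * a ≤ 1) :
    ContinuousOn (fun U : Site d → Fin d → (Matrix n n ℂ)ˣ => rescale L (bavg L U))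
      {U | IsUnitaryCfg U ∧ SmallField U a} := by
  refine continuousOn_pi.mpr fun z => continuousOn_pi.mpr fun κ => ?_
  simp only [rescale_apply, bavg]
  refine ContinuousOn.mul ?_ (continuous_hol _ _).continuousOn
  -- the exponential factor, as a unit
  rw [Units.isOpenEmbedding_val.isInducing.continuousOn_iff]
  simp only [Function.comp_def, val_expUnit]
  letI : NormedAlgebra ℚ (Matrix n n ℂ) := NormedAlgebra.restrictScalars ℚ ℂ (Matrix n n ℂ)
  exact NormedSpace.exp_continuous.comp_continuousOn (continuousOn_Xavg L hL ha hsmall _ κ)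

/-! ## §4 All intermediate averages of a small-field configuration stay small (B7 Prop. 1 iterated, scale by scale) -/

/-- The radius bookkeeping of one averaging step, scale by scale: with `s_m := ε + (16/3)·C₀·ε²·4^{−m}` and
`16·C₀·ε ≤ 3` (`C₀ = 226·(8(d+1)(d+4))²`), B7 Prop. 1's radius map `a ↦ L²a + C₀(L²a)²` sends `s_{m+1}/(L^{m+1})²` below
`s_m/(L^m)²` (`L ≥ 2`): the second-order loss at the scale `L^{−m}` is `≤ 4C₀ε²·4^{−m}`, a convergent geometric series.
[folklore] -/
theorem avgRadius_scale_step {L : ℕ} (hL : 2 ≤ L) {ε : ℝ} (hε0 : 0 ≤ ε) (hε1 : 16 * C0 d * ε ≤ 3) (m : ℕ) :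
    avgRadius d L ((ε + 16 / 3 * C0 d * ε ^ 2 * (1 / 4 : ℝ) ^ (m + 1)) / ((L : ℝ) ^ (m + 1)) ^ 2)
      ≤ (ε + 16 / 3 * C0 d * ε ^ 2 * (1 / 4 : ℝ) ^ m) / ((L : ℝ) ^ m) ^ 2 := by
  have hC : 0 < C0 d := C0_pos d
  have hL2 : (2 : ℝ) ≤ L := by exact_mod_cast hL
  have hLpos : (0 : ℝ) < L := by linarith
  set θ : ℝ := (1 / 4 : ℝ) ^ m with hθ
  set P : ℝ := ((L : ℝ) ^ m) ^ 2 with hP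
  have hθ0 : 0 < θ := by positivity
  have hθ1 : θ ≤ 1 := pow_le_one₀ (by norm_num) (by norm_num)
  have hP0 : 0 < P := by positivity
  -- `1/P ≤ θ`: `4^m ≤ (L^m)^2`
  have hPθ : P⁻¹ ≤ θ := by
    have h4 : (4 : ℝ) ^ m ≤ P := by
      rw [hP, ← pow_mul, mul_comm, pow_mul]
      exact pow_le_pow_left₀ (by norm_num) (by nlinarith) m
    have h4pos : (0 : ℝ) < 4 ^ m := by positivity
    rw [hθ, one_div, inv_pow]
    exact (inv_le_inv₀ hP0 h4pos).mpr h4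
  set s : ℝ := ε + 16 / 3 * C0 d * ε ^ 2 * (1 / 4 : ℝ) ^ (m + 1) with hs
  have hs0 : 0 ≤ s := by positivity
  have hεC : 16 / 3 * C0 d * ε ^ 2 ≤ ε := by nlinarith
  have hs2 : s ≤ 2 * ε := by
    have : (1 / 4 : ℝ) ^ (m + 1) ≤ 1 := pow_le_one₀ (by norm_num) (by norm_num)
    have h1 : 16 / 3 * C0 d * ε ^ 2 * (1 / 4 : ℝ) ^ (m + 1) ≤ 16 / 3 * C0 d * ε ^ 2 * 1 :=
      mul_le_mul_of_nonneg_left this (by positivity)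
    linarith
  -- the radius map at `a = s/(L²P)`, rewritten as `(s + C₀ s²/P)/P`
  have hpow : ((L : ℝ) ^ (m + 1)) ^ 2 = (L : ℝ) ^ 2 * P := by rw [hP]; ring
  have hrad : avgRadius d L (s / ((L : ℝ) ^ (m + 1)) ^ 2) = (s + C0 d * s ^ 2 / P) / P := by
    rw [hpow]
    unfold avgRadius C0
    field_simp
  rw [hrad]
  refine div_le_div_of_nonneg_right ?_ hP0.le
  -- `s + C₀ s²/P ≤ ε + (16/3) C₀ ε² θ`
  have h1 : C0 d * s ^ 2 / P ≤ C0 d * (2 * ε) ^ 2 * θ := by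
    rw [div_eq_mul_inv]
    have : s ^ 2 ≤ (2 * ε) ^ 2 := pow_le_pow_left₀ hs0 hs2 2
    gcongr
  have h2 : (1 / 4 : ℝ) ^ (m + 1) = θ / 4 := by rw [hθ, pow_succ]; ring
  rw [hs, h2] at h1 ⊢
  nlinarith [h1]

/-- **ALL INTERMEDIATE AVERAGES OF A SMALL-FIELD CONFIGURATION ARE UNITARY AND SMALL-FIELD, UNIFORMLY IN THE NUMBER
OF STEPS** (B7 Prop. 1 = tree `prop1_explicit`, through `MinimalActionLevels.smallField_rescale_bavg`, iterated with the
scale-by-scale bookkeeping `avgRadius_scale_step`): if `U` is `U(N)`-valued with `SmallField U (ε/(L^k)²)`, `L ≥ 2`,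
`16·C₀·ε ≤ 3` and `1024(d+1)(d+4)L²ε ≤ 1`, then for `j + m = k` the `j`-fold average `Ū^j` is `U(N)`-valued with
`SmallField Ū^j ((ε + (16/3)C₀ε²4^{−m})/(L^m)²)`. (B7 Prop. 2 (54) in the tree's `≤`-vocabulary; cf.
`B7Prop2Explicit.prop2_unitaryUnits`.) [cite: Balaban1985Averaging, Prop. 2 (52)–(54) p.26] -/
theorem avgIter_unitary_smallField [Nonempty n] {L : ℕ} (hL : 2 ≤ L)
    {U : Site d → Fin d → (Matrix n n ℂ)ˣ} (hU : IsUnitaryCfg U) {ε : ℝ} (hε0 : 0 ≤ ε)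
    (hε1 : 16 * C0 d * ε ≤ 3) (hε2 : 1024 * (d + 1) * (d + 4) * (L : ℝ) ^ 2 * ε ≤ 1) {k : ℕ}
    (hUε : SmallField U (ε / ((L : ℝ) ^ k) ^ 2)) :
    ∀ j m : ℕ, j + m = k → IsUnitaryCfg (avgIter L U j) ∧
      SmallField (avgIter L U j) ((ε + 16 / 3 * C0 d * ε ^ 2 * (1 / 4 : ℝ) ^ m) / ((L : ℝ) ^ m) ^ 2) := by
  have hC : 0 < C0 d := C0_pos d
  have hL1 : 1 ≤ L := le_trans (by norm_num) hL
  have hL1r : (1 : ℝ) ≤ L := by exact_mod_cast hL1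
  have hεC : 16 / 3 * C0 d * ε ^ 2 ≤ ε := by nlinarith
  intro j
  induction j with
  | zero =>
      intro m hm
      obtain rfl : m = k := by simpa using hm
      refine ⟨by simpa using hU, ?_⟩
      rw [avgIter_zero]
      refine MinimalActionRate.SmallField.mono hUε (div_le_div_of_nonneg_right ?_ (by positivity))
      have : 0 ≤ 16 / 3 * C0 d * ε ^ 2 * (1 / 4 : ℝ) ^ m := by positivity
      linarith
  | succ j ih =>
      intro m hm
      obtain ⟨hWu, hWs⟩ := ih (m + 1) (by omega)
      set a : ℝ := (ε + 16 / 3 * C0 d * ε ^ 2 * (1 / 4 : ℝ) ^ (m + 1)) / ((L : ℝ) ^ (m + 1)) ^ 2 with ha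
      have ha0 : 0 ≤ a := by positivity
      -- `a ≤ 2ε`, hence the smallness hypothesis of Prop. 1
      have hden : (1 : ℝ) ≤ ((L : ℝ) ^ (m + 1)) ^ 2 := one_le_pow₀ (one_le_pow₀ hL1r)
      have hnum : ε + 16 / 3 * C0 d * ε ^ 2 * (1 / 4 : ℝ) ^ (m + 1) ≤ 2 * ε := by
        have : (1 / 4 : ℝ) ^ (m + 1) ≤ 1 := pow_le_one₀ (by norm_num) (by norm_num)
        have h1 : 16 / 3 * C0 d * ε ^ 2 * (1 / 4 : ℝ) ^ (m + 1) ≤ 16 / 3 * C0 d * ε ^ 2 * 1 :=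
          mul_le_mul_of_nonneg_left this (by positivity)
        linarith
      have ha2 : a ≤ 2 * ε := by
        rw [ha]
        exact (div_le_self (by positivity) hden).trans hnum
      have hsmall : 512 * (d + 1) * (d + 4) * (L : ℝ) ^ 2 * a ≤ 1 := by
        have : 512 * ((d : ℝ) + 1) * (d + 4) * (L : ℝ) ^ 2 * a ≤ 512 * ((d : ℝ) + 1) * (d + 4) * (L : ℝ) ^ 2 * (2 * ε) :=
          mul_le_mul_of_nonneg_left ha2 (by positivity)
        linarith
      rw [avgIter_succ]
      exact ⟨isUnitaryCfg_rescale_bavg L hL1 hWu ha0 hsmall hWs,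
        MinimalActionRate.SmallField.mono (smallField_rescale_bavg L hL1 hWu ha0 hsmall hWs)
          (avgRadius_scale_step hL hε0 hε1 m)⟩

/-- In particular every `Ū^j`, `j ≤ k`, is `U(N)`-valued with `SmallField Ū^j (2ε)` (radius independent of `j, k`).
[cite: Balaban1985Averaging, Prop. 2 (54) p.26] -/
theorem avgIter_unitary_smallField_two [Nonempty n] {L : ℕ} (hL : 2 ≤ L)
    {U : Site d → Fin d → (Matrix n n ℂ)ˣ} (hU : IsUnitaryCfg U) {ε : ℝ} (hε0 : 0 ≤ ε)
    (hε1 : 16 * C0 d * ε ≤ 3) (hε2 : 1024 * (d + 1) * (d + 4) * (L : ℝ) ^ 2 * ε ≤ 1) {k : ℕ}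
    (hUε : SmallField U (ε / ((L : ℝ) ^ k) ^ 2)) {j : ℕ} (hj : j ≤ k) :
    IsUnitaryCfg (avgIter L U j) ∧ SmallField (avgIter L U j) (2 * ε) := by
  have hC : 0 < C0 d := C0_pos d
  have hL1r : (1 : ℝ) ≤ L := by exact_mod_cast (le_trans (by norm_num) hL : 1 ≤ L)
  have hεC : 16 / 3 * C0 d * ε ^ 2 ≤ ε := by nlinarith
  obtain ⟨hu, hs⟩ := avgIter_unitary_smallField hL hU hε0 hε1 hε2 hUε j (k - j) (by omega)
  refine ⟨hu, MinimalActionRate.SmallField.mono hs ?_⟩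
  have hden : (1 : ℝ) ≤ ((L : ℝ) ^ (k - j)) ^ 2 := one_le_pow₀ (one_le_pow₀ hL1r)
  have hnum : ε + 16 / 3 * C0 d * ε ^ 2 * (1 / 4 : ℝ) ^ (k - j) ≤ 2 * ε := by
    have : (1 / 4 : ℝ) ^ (k - j) ≤ 1 := pow_le_one₀ (by norm_num) (by norm_num)
    have h1 : 16 / 3 * C0 d * ε ^ 2 * (1 / 4 : ℝ) ^ (k - j) ≤ 16 / 3 * C0 d * ε ^ 2 * 1 :=
      mul_le_mul_of_nonneg_left this (by positivity)
    linarith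
  exact (div_le_self (by positivity) hden).trans hnum

/-! ## §5 Continuity of the `k`-fold average (43) on the small-field class -/

/-- **THE `j`-FOLD AVERAGE (43) IS CONTINUOUS ON THE SMALL-FIELD CLASS OF LEVEL `k`** (`j ≤ k`; product topology on
configurations): by §4 every intermediate average stays in `SmallField · (2ε)` with `512(d+1)(d+4)L²·2ε ≤ 1`, where the
one-step average is continuous (§3). [folklore] -/
theorem continuousOn_avgIter [Nonempty n] {L : ℕ} (hL : 2 ≤ L) {ε : ℝ} (hε0 : 0 ≤ ε)
    (hε1 : 16 * C0 d * ε ≤ 3) (hε2 : 1024 * (d + 1) * (d + 4) * (L : ℝ) ^ 2 * ε ≤ 1) (k : ℕ) :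
    ∀ j ≤ k, ContinuousOn (fun U : Site d → Fin d → (Matrix n n ℂ)ˣ => avgIter L U j)
      {U | IsUnitaryCfg U ∧ SmallField U (ε / ((L : ℝ) ^ k) ^ 2)} := by
  have hL1 : 1 ≤ L := le_trans (by norm_num) hL
  have h2ε0 : 0 ≤ 2 * ε := by positivity
  have h2ε : 512 * (d + 1) * (d + 4) * (L : ℝ) ^ 2 * (2 * ε) ≤ 1 := by linarith
  intro j
  induction j with
  | zero =>
      intro _
      exact continuousOn_id.congr fun U _ => avgIter_zero L U
  | succ j ih =>
      intro hj
      have hstep := continuousOn_rescale_bavg (d := d) (n := n) L hL1 h2ε0 h2ε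
      have hcomp := hstep.comp (ih (by omega))
        (fun U hU => avgIter_unitary_smallField_two hL hU.1 hε0 hε1 hε2 hU.2 (by omega : j ≤ k))
      simpa only [avgIter_succ, Function.comp_def] using hcomp

end

end Summit.QuantumFields.BalabanUV.T4Continuum.MinimalActionCompact
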